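import Mathlib
import Summits.Ventures.PercRepro2.Defs
import Summits.Ventures.PercRepro2.Independence
import Summits.Ventures.PercRepro2.Harris
import Summits.Ventures.PercRepro2.Graph
import Summits.Ventures.PercRepro2.Events
import Summits.Ventures.PercRepro2.BasePendant

/-!
# Row 2′ZC at a pendant root: the expansion in the leaf weight and its first-order coefficient
(blind cell PercRepro2, mine-a g29; MINE-A.md §83.10, §83.13)

Let the root `a₁` be a LEAF: its only edge is `f = {a₁, x}`, of weight `t = p f`.  For the cluster
up-set `U = {C(a₁) ∈ 𝓔}` (with `{a₁} ∉ 𝓔`) the (ZC) expression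

  `Z = P(D)·(P(U ∩ eL) − P(U)P(eL)) − P(B)·(P(U ∩ e¬L) − P(U)P(e¬L))`

is a cubic in `t` without constant term, `Z = t·C₁ + t²·C₂ + t³·C₃` (`zc_pendant_expansion`), whose
coefficients are explicit in the probabilities with `f` pinned open (`P₁`) or closed (`P₀`), and its
FIRST-ORDER coefficient is a Harris covariance under `P₁`:

  `C₁ = P₁(U ∩ e ∩ γ) − P₁(γ)·P₁(U ∩ e) ≥ 0`   (`first_order_coeff_eq_cov`, `first_order_coeff_nonneg`).

This is the `e_x` Bernstein coefficient of (ZC) in the attachment probabilities — the profile at which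
every attachment-independent reformulation of the row (`ThetaPA`, `(ZC-N)`) fails.
-/

namespace Summit.Ventures.PercRepro2

namespace ZCPendant

section Leaf

variable {V : Type*} {E : Type*} {ends : E → Sym2 V} {a₁ x : V} {f : E}

/-- With the leaf edge closed, the root's cluster is `{a₁}`. -/
lemma cluster_leaf_closed (hf : ends f = s(a₁, x)) (hleaf : ∀ e, a₁ ∈ ends e → e = f)
    (hx : a₁ ≠ x) {ω : Config E} (hωf : ω f = false) : cluster ends ω a₁ = {a₁} := by
  ext v
  simp only [mem_cluster, Set.mem_singleton_iff]
  constructor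
  · intro h
    exact conn_leaf_closed hf hleaf hx hωf h
  · intro hv
    subst hv
    exact conn_refl ends ω _

/-- A connection event of the root lies in `{f open}`. -/
lemma connEvent_root_subset_openEdge (hf : ends f = s(a₁, x)) (hleaf : ∀ e, a₁ ∈ ends e → e = f)
    (hx : a₁ ≠ x) {v : V} (hv : v ≠ a₁) : connEvent ends a₁ v ⊆ openEdge f := by
  intro ω hω
  by_contra hcl
  have hωf : ω f = false := by
    rw [mem_openEdge] at hcl
    exact Bool.eq_false_iff.mpr hcl
  exact hv (conn_leaf_closed hf hleaf hx hωf hω)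

/-- A cluster up-set event of the root not containing `{a₁}` lies in `{f open}`. -/
lemma clusterInEvent_root_subset_openEdge (hf : ends f = s(a₁, x))
    (hleaf : ∀ e, a₁ ∈ ends e → e = f) (hx : a₁ ≠ x) {𝓔 : Set (Set V)}
    (hE1 : ({a₁} : Set V) ∉ 𝓔) : clusterInEvent ends a₁ 𝓔 ⊆ openEdge f := by
  intro ω hω
  by_contra hcl
  have hωf : ω f = false := by
    rw [mem_openEdge] at hcl
    exact Bool.eq_false_iff.mpr hcl
  rw [mem_clusterInEvent, cluster_leaf_closed hf hleaf hx hωf] at hω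
  exact hE1 hω

end Leaf

section LeafProb

variable {V : Type*} {E : Type*} [Fintype E] [DecidableEq E] {R : Type*} [Field R]
  {ends : E → Sym2 V} {a₁ x : V} {f : E}

omit [Fintype E] in
/-- The indicator of a connection event away from the root is unchanged by pinning the leaf edge. -/
lemma indicator_connEvent_update (hf : ends f = s(a₁, x)) (hleaf : ∀ e, a₁ ∈ ends e → e = f)
    (hx : a₁ ≠ x) {u v : V} (hu : u ≠ a₁) (hv : v ≠ a₁) (c : Bool) (ω : Config E) :
    (connEvent ends u v).indicator (1 : Config E → R) (Function.update ω f c) =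
      (connEvent ends u v).indicator 1 ω := by
  by_cases h : ω ∈ connEvent ends u v
  · have h' : Function.update ω f c ∈ connEvent ends u v := by
      rw [mem_connEvent] at h ⊢
      exact (conn_update_leaf_iff hf hleaf hx c hu hv).mpr h
    rw [Set.indicator_of_mem h, Set.indicator_of_mem h']
    rfl
  · have h' : Function.update ω f c ∉ connEvent ends u v := by
      intro h'
      apply h
      rw [mem_connEvent] at h' ⊢
      exact (conn_update_leaf_iff hf hleaf hx c hu hv).mp h'
    rw [Set.indicator_of_notMem h, Set.indicator_of_notMem h']

/-- Pinning the leaf edge open does not change the probability of a connection event away from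
the root. -/
lemma prob_update_one_connEvent (hf : ends f = s(a₁, x)) (hleaf : ∀ e, a₁ ∈ ends e → e = f)
    (hx : a₁ ≠ x) (p : E → R) {u v : V} (hu : u ≠ a₁) (hv : v ≠ a₁) :
    prob (Function.update p f 1) (connEvent ends u v) = prob p (connEvent ends u v) := by
  rw [prob_eq_expect_indicator, prob_eq_expect_indicator, expect_update_one]
  exact congrArg (expect p) (funext fun ω => indicator_connEvent_update hf hleaf hx hu hv true ω)

/-- Pinning the leaf edge closed does not change the probability of a connection event away from
the root. -/
lemma prob_update_zero_connEvent (hf : ends f = s(a₁, x)) (hleaf : ∀ e, a₁ ∈ ends e → e = f)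
    (hx : a₁ ≠ x) (p : E → R) {u v : V} (hu : u ≠ a₁) (hv : v ≠ a₁) :
    prob (Function.update p f 0) (connEvent ends u v) = prob p (connEvent ends u v) := by
  rw [prob_eq_expect_indicator, prob_eq_expect_indicator, expect_update_zero]
  exact congrArg (expect p) (funext fun ω => indicator_connEvent_update hf hleaf hx hu hv false ω)

end LeafProb

section Pin

variable {E : Type*} [Fintype E] [DecidableEq E] {R : Type*} [Field R] {f : E}

/-- An event inside `{f open}`: its probability is `p f` times its probability with `f` pinned open. -/
lemma prob_eq_mul_update_one_of_subset (p : E → R) {A : Set (Config E)} (hA : A ⊆ openEdge f) :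
    prob p A = p f * prob (Function.update p f 1) A := by
  have := prob_inter_openEdge p A f
  rwa [Set.inter_eq_left.mpr hA] at this

/-- An event inside `{f open}` has probability `0` with `f` pinned closed. -/
lemma prob_update_zero_of_subset (p : E → R) {A : Set (Config E)} (hA : A ⊆ openEdge f) :
    prob (Function.update p f 0) A = 0 := by
  have := prob_update_zero_inter_openEdge p A f
  rwa [Set.inter_eq_left.mpr hA] at this

/-- With `f` pinned closed, `(A₁ᶜ ∩ A₂ᶜ) ∩ B` has the probability of `B` when `A₁, A₂ ⊆ {f open}`. -/
lemma prob_update_zero_compl_inter (p : E → R) {A₁ A₂ B : Set (Config E)} (h₁ : A₁ ⊆ openEdge f)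
    (h₂ : A₂ ⊆ openEdge f) :
    prob (Function.update p f 0) (A₁ᶜ ∩ A₂ᶜ ∩ B) = prob (Function.update p f 0) B := by
  rw [← prob_update_zero_inter_closedEdge p (A₁ᶜ ∩ A₂ᶜ ∩ B) f,
    ← prob_update_zero_inter_closedEdge p B f]
  congr 1
  ext ω
  simp only [Set.mem_inter_iff, Set.mem_compl_iff, mem_closedEdge]
  constructor
  · intro h
    exact ⟨h.1.2, h.2⟩
  · intro h
    refine ⟨⟨⟨fun h1 => ?_, fun h2 => ?_⟩, h.1⟩, h.2⟩
    · have := h₁ h1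
      rw [mem_openEdge, h.2] at this
      exact Bool.false_ne_true this
    · have := h₂ h2
      rw [mem_openEdge, h.2] at this
      exact Bool.false_ne_true this

end Pin

section Transitivity

variable {V : Type*} {E : Type*} (ends : E → Sym2 V) (a₁ a₃ o : V)

/-- `{a₁ ↔ a₃} ∩ {a₁ ↔ o} = {a₁ ↔ a₃} ∩ {a₃ ↔ o}`. -/
lemma connEvent_inter_eq_inter_connEvent :
    connEvent ends a₁ a₃ ∩ connEvent ends a₁ o = connEvent ends a₁ a₃ ∩ connEvent ends a₃ o := by
  ext ω
  simp only [Set.mem_inter_iff, mem_connEvent]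
  constructor
  · rintro ⟨h1, h2⟩
    exact ⟨h1, conn_trans (conn_symm h1) h2⟩
  · rintro ⟨h1, h3⟩
    exact ⟨h1, conn_trans h1 h3⟩

/-- `{a₁ ↔ a₃} ∩ {a₁ ↮ o} = {a₁ ↔ a₃} ∩ {a₃ ↮ o}`. -/
lemma connEvent_inter_compl_eq_inter_compl :
    connEvent ends a₁ a₃ ∩ (connEvent ends a₁ o)ᶜ =
      connEvent ends a₁ a₃ ∩ (connEvent ends a₃ o)ᶜ := by
  ext ω
  simp only [Set.mem_inter_iff, Set.mem_compl_iff, mem_connEvent]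
  constructor
  · rintro ⟨h1, h2⟩
    exact ⟨h1, fun h3 => h2 (conn_trans h1 h3)⟩
  · rintro ⟨h1, h3⟩
    exact ⟨h1, fun h2 => h3 (conn_trans (conn_symm h1) h2)⟩

end Transitivity

section Expansion

variable {V : Type*} {E : Type*} [Fintype E] [DecidableEq E] {R : Type*} [Field R]
  {ends : E → Sym2 V} {a₁ x : V} {f : E}

/-- **The (ZC) expression at a pendant root is a cubic in the leaf weight without constant term**,
`Z = t·C₁ + t²·C₂ + t³·C₃`, with explicit coefficients in the pinned probabilities `P₁` (`f` open)
and `P₀` (`f` closed); `C₁ = P₀(γᶜ)·P₁(U ∩ eL) − P₀(γ)·P₁(U ∩ e¬L)`. -/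
theorem zc_pendant_expansion (hf : ends f = s(a₁, x)) (hleaf : ∀ e, a₁ ∈ ends e → e = f)
    (hx : a₁ ≠ x) (p : E → R) {𝓔 : Set (Set V)} (hE1 : ({a₁} : Set V) ∉ 𝓔) {a₃ o : V}
    (h3 : a₃ ≠ a₁) (ho : o ≠ a₁) :
    let e := connEvent ends a₁ a₃
    let L := connEvent ends a₁ o
    let γ := connEvent ends a₃ o
    let U := clusterInEvent ends a₁ 𝓔
    let t := p f
    let P₁ := Function.update p f (1 : R)
    let P₀ := Function.update p f (0 : R)
    let D₁ := prob P₁ (eᶜ ∩ Lᶜ ∩ γᶜ)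
    let B₁ := prob P₁ (eᶜ ∩ Lᶜ ∩ γ)
    let D₀ := prob P₀ γᶜ
    let B₀ := prob P₀ γ
    let C₁ := D₀ * prob P₁ (U ∩ (e ∩ L)) - B₀ * prob P₁ (U ∩ (e ∩ Lᶜ))
    let C₂ := (D₁ - D₀) * prob P₁ (U ∩ (e ∩ L)) - D₀ * (prob P₁ U * prob P₁ (e ∩ L)) -
      (B₁ - B₀) * prob P₁ (U ∩ (e ∩ Lᶜ)) + B₀ * (prob P₁ U * prob P₁ (e ∩ Lᶜ))
    let C₃ := -((D₁ - D₀) * (prob P₁ U * prob P₁ (e ∩ L))) +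
      (B₁ - B₀) * (prob P₁ U * prob P₁ (e ∩ Lᶜ))
    prob p (eᶜ ∩ Lᶜ ∩ γᶜ) * (prob p (U ∩ (e ∩ L)) - prob p U * prob p (e ∩ L)) -
        prob p (eᶜ ∩ Lᶜ ∩ γ) * (prob p (U ∩ (e ∩ Lᶜ)) - prob p U * prob p (e ∩ Lᶜ)) =
      t * C₁ + t ^ 2 * C₂ + t ^ 3 * C₃ := by
  intro e L γ U t P₁ P₀ D₁ B₁ D₀ B₀ C₁ C₂ C₃
  have he : e ⊆ openEdge f := connEvent_root_subset_openEdge hf hleaf hx h3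
  have hL : L ⊆ openEdge f := connEvent_root_subset_openEdge hf hleaf hx ho
  have hU : U ⊆ openEdge f := clusterInEvent_root_subset_openEdge hf hleaf hx hE1
  have hUeL : prob p (U ∩ (e ∩ L)) = t * prob P₁ (U ∩ (e ∩ L)) :=
    prob_eq_mul_update_one_of_subset p (Set.inter_subset_left.trans hU)
  have hUenL : prob p (U ∩ (e ∩ Lᶜ)) = t * prob P₁ (U ∩ (e ∩ Lᶜ)) :=
    prob_eq_mul_update_one_of_subset p (Set.inter_subset_left.trans hU)
  have hPU : prob p U = t * prob P₁ U := prob_eq_mul_update_one_of_subset p hU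
  have heL : prob p (e ∩ L) = t * prob P₁ (e ∩ L) :=
    prob_eq_mul_update_one_of_subset p (Set.inter_subset_left.trans he)
  have henL : prob p (e ∩ Lᶜ) = t * prob P₁ (e ∩ Lᶜ) :=
    prob_eq_mul_update_one_of_subset p (Set.inter_subset_left.trans he)
  have hD : prob p (eᶜ ∩ Lᶜ ∩ γᶜ) = t * D₁ + (1 - t) * D₀ := by
    rw [prob_eq_pin p _ f]
    congr 2
    exact prob_update_zero_compl_inter p he hL
  have hB : prob p (eᶜ ∩ Lᶜ ∩ γ) = t * B₁ + (1 - t) * B₀ := by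
    rw [prob_eq_pin p _ f]
    congr 2
    exact prob_update_zero_compl_inter p he hL
  rw [hUeL, hUenL, hPU, heL, henL, hD, hB]
  ring

/-- **The first-order coefficient is a Harris covariance** under the measure with `f` pinned open:
`C₁ = P₁(U ∩ e ∩ γ) − P₁(γ)·P₁(U ∩ e)`. -/
theorem first_order_coeff_eq_cov (hf : ends f = s(a₁, x)) (hleaf : ∀ e, a₁ ∈ ends e → e = f)
    (hx : a₁ ≠ x) (p : E → R) (𝓔 : Set (Set V)) {a₃ o : V} (h3 : a₃ ≠ a₁) (ho : o ≠ a₁) :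
    let e := connEvent ends a₁ a₃
    let L := connEvent ends a₁ o
    let γ := connEvent ends a₃ o
    let U := clusterInEvent ends a₁ 𝓔
    let P₁ := Function.update p f (1 : R)
    let P₀ := Function.update p f (0 : R)
    prob P₀ γᶜ * prob P₁ (U ∩ (e ∩ L)) - prob P₀ γ * prob P₁ (U ∩ (e ∩ Lᶜ)) =
      prob P₁ (U ∩ e ∩ γ) - prob P₁ γ * prob P₁ (U ∩ e) := by
  intro e L γ U P₁ P₀
  have hγ : prob P₀ γ = prob P₁ γ := by
    rw [prob_update_zero_connEvent hf hleaf hx p h3 ho, prob_update_one_connEvent hf hleaf hx p h3 ho]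
  have hγc : prob P₀ γᶜ = 1 - prob P₁ γ := by
    rw [prob_compl, hγ]
  have h1 : U ∩ (e ∩ L) = U ∩ e ∩ γ := by
    rw [connEvent_inter_eq_inter_connEvent, Set.inter_assoc]
  have h2 : U ∩ (e ∩ Lᶜ) = U ∩ e ∩ γᶜ := by
    rw [connEvent_inter_compl_eq_inter_compl, Set.inter_assoc]
  have h3' : prob P₁ (U ∩ e ∩ γᶜ) = prob P₁ (U ∩ e) - prob P₁ (U ∩ e ∩ γ) := by
    have := prob_inter_add_prob_inter_compl P₁ (U ∩ e) γ
    linear_combination this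
  rw [hγc, hγ, h1, h2, h3']
  ring

end Expansion

section Harris

variable {V : Type*} {E : Type*} [Fintype E] [DecidableEq E] {R : Type*} [Field R] [LinearOrder R]
  [IsStrictOrderedRing R] {ends : E → Sym2 V} {a₁ : V} {f : E}

/-- **The first-order pendant coefficient of (ZC) is nonnegative** (Harris: `γ` and `U ∩ e` are
increasing). -/
theorem first_order_coeff_nonneg (p : E → R) (hp : IsProbVec p) {𝓔 : Set (Set V)}
    (h𝓔 : IsUpperSet 𝓔) (a₃ o : V) :
    let e := connEvent ends a₁ a₃
    let γ := connEvent ends a₃ o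
    let U := clusterInEvent ends a₁ 𝓔
    let P₁ := Function.update p f (1 : R)
    0 ≤ prob P₁ (U ∩ e ∩ γ) - prob P₁ γ * prob P₁ (U ∩ e) := by
  intro e γ U P₁
  have hP₁ : IsProbVec P₁ := hp.update f zero_le_one le_rfl
  have hUe : IsUpperSet (U ∩ e) :=
    (isUpperSet_clusterInEvent ends a₁ h𝓔).inter (isUpperSet_connEvent ends a₁ a₃)
  have := prob_mul_prob_le_prob_inter hP₁ hUe (isUpperSet_connEvent ends a₃ o)
  rw [mul_comm] at this
  linarith

end Harris

end ZCPendant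

end Summit.Ventures.PercRepro2
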